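import Literature.MathematicalPhysics.KineticTheory.LangevinChainLocalMinorization
import Literature.MathematicalPhysics.KineticTheory.LangevinChainH2Proof
import Literature.Analysis.Hypoelliptic.HormanderProof
import HarnessLib

/-!
# Cuneo–Eckmann–Hairer–Rey-Bellet 2018, Theorem 2.13 for the pinned chain: the ergodic part
PROVED, and the reduction of `CuneoEckmannHairerReyBellet2018_thm213` to hypoelliptic regularity

Trunk T-KINETIC (Literature/MathematicalPhysics/KineticTheory). Proof file of the provefact unit for
the named fact `CuneoEckmannHairerReyBellet2018_thm213` (`LangevinSemigroup.lean`: N. Cuneo,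
J.-P. Eckmann, M. Hairer, L. Rey-Bellet, *Non-equilibrium steady states for networks of
oscillators*, Electron. J. Probab. 23 (2018) no. 55, Theorem 2.13 (1)–(3), for the pinned anharmonic
chain `pinnedChain ω₂ lam β γ`). Everything here is PROVED; no definition and no named fact is
introduced.

The printed proof (CEHR §3) has three deep inputs: the Lyapunov condition H2 (Thm 5.1 / Rem 5.2),
the minorisation of Prop. 3.6 (from Props. 3.2–3.3), and the smoothness of invariant densities
(Prop. 3.2, Hörmander 1967 Thm 1.1 with the bracket condition of Prop. 4.1). The first is proved in
the tree (`CuneoEckmannHairerReyBellet2018_H2_holds`, `LangevinChainH2Proof.lean`); the second is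
proved Hörmander-free for the constructed transition semigroup (`pinnedChain_localSmall` and
`pinnedChain_minorization_of_localSmall`, `LangevinChainLocalMinorization.lean`,
`LangevinChainMinorization.lean`); Harris' theorem (Hairer–Mattingly 2011) and the passage to
continuous time are proved in `LangevinChainHarris.lean`. Joining them:

* `pinnedChain_minorization` — **CEHR Prop. 3.6 for the pinned chain, unconditionally**: every
  compact set of phase space is small for the transition kernels `P_t` at all large times.
* `pinnedChainSemigroup_ergodic` — **Theorem 2.13 (1) [uniqueness], (2) and (3) for the transition
  semigroup `pinnedChainSemigroup` of the SDE (2.2), unconditionally**: at most one invariant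
  probability measure; an invariant probability measure `μ⋆` integrating `e^{ϑH}` for every
  `0 < ϑ < 1/max(T_L,T_R)`; and the exponential convergence (2.5) in the `e^{ϑH}`-weighted norm.
* `CuneoEckmannHairerReyBellet2018_thm213_of_smoothDensity` — the named fact follows from the
  smooth-density fact `CuneoEckmannHairerReyBellet2018_smoothDensity` (`LangevinChainLyapunov.lean`;
  hypoellipticity of `L*`) ALONE, and
* `CuneoEckmannHairerReyBellet2018_thm213_of_hormander` — hence from Hörmander 1967, Thm 1.1
  (`Literature.Analysis.Distribution.Hormander1967_thm11`) alone, via the proved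
  `CuneoEckmannHairerReyBellet2018_smoothDensity_of_hormander` (`LangevinChainHormander.lean`).

So the only deep external input of `CuneoEckmannHairerReyBellet2018_thm213` is Hörmander's
hypoellipticity theorem, which enters only through the clause "it has a smooth density with
respect to Lebesgue measure" of Theorem 2.13 (1); that theorem is itself proved in the tree
(`Literature.Analysis.Hypoelliptic.hormander1967_thm11_proof`, `HormanderProof.lean`, assembled
from `Literature/Analysis/Hypoelliptic/*`), and the last declaration of this file is the closed
discharge `CuneoEckmannHairerReyBellet2018_thm213_holds`.

## References

* [CuneoEckmannHairerReyBellet2018] N. Cuneo, J.-P. Eckmann, M. Hairer, L. Rey-Bellet,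
  *Non-equilibrium steady states for networks of oscillators*, Electron. J. Probab. 23 (2018)
  no. 55 (arXiv:1712.09413): Thm 2.13, §3 Props. 3.2, 3.6, 3.7, 3.8, Thm 5.1 / Rem 5.2 (page and
  line references in the imported files refer to the arXiv version).
* [HairerMattingly2011] M. Hairer, J. C. Mattingly, *Yet another look at Harris' ergodic theorem for
  Markov chains*, Progr. Probab. 63 (2011) 109–117.
* [Hormander1967] L. Hörmander, *Hypoelliptic second order differential equations*, Acta Math. 119
  (1967) 147–171, Thm 1.1.
-/

noncomputable section

open MeasureTheory ProbabilityTheory Filter Topology Set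
open scoped NNReal ENNReal

namespace Literature.MathematicalPhysics.KineticTheory.HeatConduction

open Literature.Probability.Process OscillatorChain

variable {N : ℕ}

section Pinned

variable {ω₂ lam β γ : ℝ} (hω : 0 < ω₂) (hl : 0 ≤ lam) (hβ : 0 < β) (hγ : 0 < γ)
  (hN : 0 < N) {T_L T_R : ℝ} (hL : 0 < T_L) (hR : 0 < T_R)
include hω hl hβ hγ hN hL hR

/-- **Cuneo–Eckmann–Hairer–Rey-Bellet 2018, Prop. 3.6 for the pinned chain, PROVED
unconditionally.** Printed: "Assume H1 holds. Then for every compact set `C` there is `t_C` such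
that for all `t ≥ t_C` there is a non-trivial measure `ν` with `P_t(z, ·) ≥ ν` for all `z ∈ C`."
For the transition kernels of `pinnedChain ω₂ lam β γ` (`ω₂, β, γ > 0`, `lam ≥ 0`, `N ≥ 1`,
`T_L, T_R > 0`) this holds with no hypoellipticity input: the local small set at the equilibrium
(`pinnedChain_localSmall`, finite-dimensional submersion of the dyadic skeleton of the noise) is
propagated to every compact set by the Feller property and the pointed irreducibility
(`pinnedChain_minorization_of_localSmall`). [cite: CuneoEckmannHairerReyBellet2018, Prop 3.6] -/
theorem pinnedChain_minorization :
    ∀ C : Set (PhaseSpace N), IsCompact C → ∃ t_C : ℝ≥0, ∀ t : ℝ≥0, t_C ≤ t →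
      ∃ ν : Measure (PhaseSpace N), ν ≠ 0 ∧
        ∀ z ∈ C, ν ≤ (pinnedChain ω₂ lam β γ).transitionKernel N T_L T_R t z :=
  pinnedChain_minorization_of_localSmall hω hl hβ hγ hN hL hR
    (pinnedChain_localSmall hω hl hβ hγ hN hL hR)

/-- **Cuneo–Eckmann–Hairer–Rey-Bellet 2018, Theorem 2.13 (1) [uniqueness half], (2) and (3) for
the transition semigroup of the pinned chain, PROVED unconditionally.** For
`S = pinnedChainSemigroup` (the transition semigroup (2.3) of the SDE (2.2) for
`pinnedChain ω₂ lam β γ`, `ω₂, β, γ > 0`, `lam ≥ 0`, `N ≥ 1`, `T_L, T_R > 0`):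
`S` has at most one invariant probability measure; it has an invariant probability measure `μ⋆`
under which `e^{ϑH}` is integrable for every `0 < ϑ < 1/max(T_L, T_R)`; and for every such `ϑ`
there are `C, c > 0` with `|P_t f(z) - ∫ f dμ⋆| ≤ C e^{ϑH(z)} e^{-ct}` for all `z`, `t ≥ 0` and
all continuous `f` with `|f| ≤ e^{ϑH}` (printed (2.5)). Proof: H2
(`CuneoEckmannHairerReyBellet2018_H2_holds`) and Prop. 3.6 (`pinnedChain_minorization`) feed
Krylov–Bogoliubov (`pinnedChainSemigroup_exists_isInvariant`), Harris' theorem on the skeleton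
chain (`pinnedChainSemigroup_harris`; two invariant probability measures of `S` are invariant for
the skeleton, hence equal) and the continuous-time bound (`pinnedChainSemigroup_exp_convergence`).
The remaining clause of (1), smoothness of the invariant density, is the hypoelliptic input
isolated in `CuneoEckmannHairerReyBellet2018_thm213_of_smoothDensity`.
[cite: CuneoEckmannHairerReyBellet2018, Thm 2.13] -/
theorem pinnedChainSemigroup_ergodic :
    (∀ μ ν : Measure (PhaseSpace N), IsProbabilityMeasure μ → IsProbabilityMeasure ν →
        (pinnedChainSemigroup hω hl hβ.le hγ.le hN hL.le hR.le).IsInvariant μ →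
        (pinnedChainSemigroup hω hl hβ.le hγ.le hN hL.le hR.le).IsInvariant ν → μ = ν) ∧
    ∃ μs : Measure (PhaseSpace N), IsProbabilityMeasure μs ∧
      (pinnedChainSemigroup hω hl hβ.le hγ.le hN hL.le hR.le).IsInvariant μs ∧
      ∀ ϑ : ℝ, 0 < ϑ → ϑ < 1 / max T_L T_R →
        Integrable (fun z => Real.exp (ϑ * (pinnedChain ω₂ lam β γ).hamiltonian N z)) μs ∧
        ∃ C c : ℝ, 0 < C ∧ 0 < c ∧
          ∀ (z : PhaseSpace N) (t : ℝ≥0) (f : PhaseSpace N → ℝ), Continuous f →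
            (∀ y, |f y| ≤ Real.exp (ϑ * (pinnedChain ω₂ lam β γ).hamiltonian N y)) →
            |(pinnedChainSemigroup hω hl hβ.le hγ.le hN hL.le hR.le).act t f z - ∫ y, f y ∂μs| ≤
              C * Real.exp (ϑ * (pinnedChain ω₂ lam β γ).hamiltonian N z) * Real.exp (-c * t) := by
  have hTm : 0 < 1 / max T_L T_R := by positivity
  have h36 := pinnedChain_minorization hω hl hβ hγ hN hL hR
  obtain ⟨m, abar, b, -, -, -, -, huniq, -⟩ := pinnedChainSemigroup_harris hω hl hβ hγ hN hL hR
    CuneoEckmannHairerReyBellet2018_H2_holds h36 (ϑ := 1 / max T_L T_R / 2) (by positivity)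
    (half_lt_self hTm)
  obtain ⟨μs, hμs, hinv, hint⟩ := pinnedChainSemigroup_exists_isInvariant hω hl hβ hγ hN hL hR
    CuneoEckmannHairerReyBellet2018_H2_holds
  refine ⟨fun μ ν hμ hν hμi hνi => huniq μ ν hμ hν (hμi _) (hνi _), μs, hμs, hinv,
    fun ϑ hϑ0 hϑ1 => ⟨hint ϑ hϑ0 hϑ1, ?_⟩⟩
  exact pinnedChainSemigroup_exp_convergence hω hl hβ hγ hN hL hR
    CuneoEckmannHairerReyBellet2018_H2_holds h36 hϑ0 hϑ1 μs hinv

end Pinned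

/-- **Cuneo–Eckmann–Hairer–Rey-Bellet 2018, Theorem 2.13 for the pinned chain, from the
smooth-density fact alone.** If every finite weakly stationary measure of the pinned chain has a
smooth Lebesgue density (`CuneoEckmannHairerReyBellet2018_smoothDensity`: Hörmander's Theorem 1.1
for `L*` with the bracket condition of Prop. 4.1, the content of Prop. 3.2's "every invariant
measure has a smooth density"), then the named fact `CuneoEckmannHairerReyBellet2018_thm213`
holds, with witness the constructed transition semigroup: the ergodic part is
`pinnedChainSemigroup_ergodic`, and invariant probability measures are weakly stationary by
Dynkin's identity (`CuneoEckmannHairerReyBellet2018_smoothDensity.hasSmoothDensity_of_isInvariant`).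
[cite: CuneoEckmannHairerReyBellet2018, Thm 2.13 and Prop 3.2] -/
theorem CuneoEckmannHairerReyBellet2018_thm213_of_smoothDensity
    (hsd : CuneoEckmannHairerReyBellet2018_smoothDensity) :
    CuneoEckmannHairerReyBellet2018_thm213 := by
  intro ω₂ lam β γ hω hl hβ hγ N T_L T_R hN hL hR
  obtain ⟨huniq, μs, hμs, hinv, hrest⟩ := pinnedChainSemigroup_ergodic hω hl hβ hγ hN hL hR
  refine ⟨pinnedChainSemigroup hω hl hβ.le hγ.le hN hL.le hR.le, huniq, fun μ hμ hμi => ?_,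
    μs, hμs, hinv, hrest⟩
  haveI := hμ
  exact hsd.hasSmoothDensity_of_isInvariant hω hl hβ hγ hN hL hR _ μ hμi

/-- **Cuneo–Eckmann–Hairer–Rey-Bellet 2018, Theorem 2.13 for the pinned chain, from Hörmander's
Theorem 1.1 alone** (`Literature.Analysis.Distribution.Hormander1967_thm11`): by
`CuneoEckmannHairerReyBellet2018_smoothDensity_of_hormander` (the chain-specific part of Prop. 3.2
with Prop. 4.1, proved in `LangevinChainHormander.lean`) and
`CuneoEckmannHairerReyBellet2018_thm213_of_smoothDensity`. This is the whole printed proof of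
Theorem 2.13 for the pinned chain with every step proved except Hörmander's hypoellipticity
theorem. [cite: CuneoEckmannHairerReyBellet2018, Thm 2.13] [cite: Hormander1967, Thm 1.1] -/
theorem CuneoEckmannHairerReyBellet2018_thm213_of_hormander
    (hH : Literature.Analysis.Distribution.Hormander1967_thm11) :
    CuneoEckmannHairerReyBellet2018_thm213 :=
  CuneoEckmannHairerReyBellet2018_thm213_of_smoothDensity
    (CuneoEckmannHairerReyBellet2018_smoothDensity_of_hormander hH)

/-- **Cuneo–Eckmann–Hairer–Rey-Bellet 2018, Theorem 2.13 for the pinned anharmonic chain — the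
named fact `CuneoEckmannHairerReyBellet2018_thm213` HOLDS.** Printed (Electron. J. Probab. 23
(2018) no. 55, Thm 2.13): under C1–C5 "(1) The process (2.2) admits a unique invariant measure,
and it has a smooth density with respect to Lebesgue measure. (2) For all `0 < θ < 1/T_max` …
`∫ e^{θH} dμ < ∞`. (3) For all `0 < θ < 1/T_max` there exist `C, c > 0` such that
`|E_z f(z_t) - μ(f)| ≤ C e^{θH(z)} e^{-ct}` for all `|f| ≤ e^{θH}`", specialised (as vendored in
`LangevinSemigroup.lean`) to the chain `pinnedChain ω₂ lam β γ` with `ω₂, β, γ > 0`, `lam ≥ 0`,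
`N ≥ 1` sites and bath temperatures `T_L, T_R > 0` (C1–C5 hold: Rem. 2.2, Rem. 2.10). Proof = the
printed one, every step proved in the tree: `CuneoEckmannHairerReyBellet2018_thm213_of_hormander`
(well-posedness and the transition semigroup `pinnedChainSemigroup`; H2 = Thm 5.1/Rem 5.2,
`CuneoEckmannHairerReyBellet2018_H2_holds`; Prop. 3.6 minorisation, `pinnedChain_minorization`;
Krylov–Bogoliubov, Prop. 3.7; Harris' theorem of Hairer–Mattingly 2011, Prop. 3.8; smooth invariant
densities, Prop. 3.2 with Prop. 4.1) applied to Hörmander's Theorem 1.1, proved in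
`Literature/Analysis/Hypoelliptic/HormanderProof.lean` as
`Literature.Analysis.Hypoelliptic.hormander1967_thm11_proof`.
[cite: CuneoEckmannHairerReyBellet2018, Thm 2.13] [cite: Hormander1967, Thm 1.1]
[cite: HairerMattingly2011, Thm 1.2] -/
theorem CuneoEckmannHairerReyBellet2018_thm213_holds : CuneoEckmannHairerReyBellet2018_thm213 :=
  CuneoEckmannHairerReyBellet2018_thm213_of_hormander
    Literature.Analysis.Hypoelliptic.hormander1967_thm11_proof

end Literature.MathematicalPhysics.KineticTheory.HeatConduction

end
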